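import Literature.Geometry.GaugeTheory.AlmostComplexSpincFour
import Mathlib.FieldTheory.IsAlgClosed.Basic
import Mathlib.Analysis.Complex.Polynomial.Basic
import HarnessLib

/-!
# Spinor algebra in dimension four, VI: the unitary group of `(ℍ, i·)` is `{x ↦ μ x q̄}`

Topic `Literature/Geometry/GaugeTheory`; continues `AlmostComplexSpincFour.lean`, whose module
docstring lists as NOT proved "the converse inclusion `U(2)_J ⊆ {x ↦ μ x q̄}`". It is proved here
(0 new facts): **every `ℝ`-linear isometry of `V = ℍ` commuting with the model complex structure
`J = i·` is `x ↦ μ x q̄` for a unit complex number `μ` and a unit quaternion `q`**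
(`exists_spinFourAct_eq_of_commute_modelJ`). This is the fibre-level input for writing the change
of two unitary frames of an almost complex (almost Kähler) `4`-manifold in the form required by
`UnitaryFrameData.frameCoord_eq` / the canonical lift `unitaryLift μ q : U(2) → Spin^c(4)` of
Morgan 1996, §3.4 ("`U(2) = (U(1) × SU(2))/±1`", the maps `x ↦ μ x q̄`).

Proof (J. W. Morgan, *The Seiberg–Witten equations…*, §3.4, the description of `U(2) ⊂ SO(4)`;
elementary quaternion algebra): put `u = f(1)`, `v = f(j)`, unit and with `⟨u, v⟩ = ⟨iu, v⟩ = 0`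
(`f` is an isometry and `f(i) = i f(1)`), so `w = v ū ∈ span(j, k)` and `c = -j w` is a unit
COMPLEX number; with `μ̄² = c` and `q = ū μ` one checks `μ x q̄ = f(x)` on `1, i, j, k`.

## References

* J. W. Morgan, *The Seiberg–Witten Equations and Applications to the Topology of Smooth
  Four-Manifolds*, Princeton Math. Notes 44 (1996), §3.4. [MorganSWBook1996]
-/

noncomputable section

open Quaternion Complex
open scoped ComplexConjugate Quaternion InnerProductSpace

namespace Literature.Geometry.GaugeTheory

/-! ### Quaternion bookkeeping -/

/-- Components of `j * w`. [folklore] -/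
theorem quatBasis_two_mul (w : ℍ) : quatBasis 2 * w = ⟨-w.imJ, w.imK, w.re, -w.imI⟩ := by
  ext <;> simp [quatBasis]

/-- A quaternion with vanishing `j`- and `k`-components is the complex number of its first two
components. [folklore] -/
theorem eq_coeComplex_of_imJ_imK {c : ℍ} (hJ : c.imJ = 0) (hK : c.imK = 0) :
    c = ((⟨c.re, c.imI⟩ : ℂ) : ℍ) := by
  ext <;> simp [hJ, hK]

/-- `(μ : ℍ) * j = j * (μ̄ : ℍ)` for complex `μ`. [folklore] -/
theorem coeComplex_mul_quatBasis_two (μ : ℂ) :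
    (μ : ℍ) * quatBasis 2 = quatBasis 2 * ((conj μ : ℂ) : ℍ) := by
  ext <;> simp [quatBasis]

/-- `j * j = -1`. [folklore] -/
theorem quatBasis_two_mul_self : quatBasis 2 * quatBasis 2 = -1 := by
  ext <;> simp [quatBasis]

/-- `i * j = k`. [folklore] -/
theorem quatBasis_one_mul_two : quatBasis 1 * quatBasis 2 = quatBasis 3 := by
  ext <;> simp [quatBasis]

/-- The inner product `⟨a, b⟩ = Re(a b̄)` with `b = i u`: `⟨v, i u⟩ = (v ū (-i)).re = (v ū).imI`.
[folklore] -/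
theorem inner_modelJ_right (v u : ℍ) : ⟪v, modelJ u⟫_ℝ = (v * star u).imI := by
  rw [Quaternion.inner_def, modelJ_eq, star_mul, ← mul_assoc]
  have hs : star (quatBasis 1) = -quatBasis 1 := by ext <;> simp [quatBasis]
  rw [hs, mul_neg, Quaternion.re_neg]
  set w := v * star u
  simp [quatBasis]

/-! ### The theorem -/

/-- **`U(2) ⊆ {x ↦ μ x q̄}`**: an `ℝ`-linear isometry `f` of `ℍ` commuting with `J = i·` is
`x ↦ μ x q̄` for some unit `μ ∈ ℂ`, `q ∈ ℍ` (Morgan 1996, §3.4: the unitary group of `(V, J)` inside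
`SO(4) = (S³ × S³)/±1` is `(U(1) × SU(2))/±1`). [cite: MorganSWBook1996, §3.4] -/
theorem exists_spinFourAct_eq_of_commute_modelJ (f : ℍ →ₗ[ℝ] ℍ) (hf : ∀ x, ‖f x‖ = ‖x‖)
    (hJ : ∀ x, f (modelJ x) = modelJ (f x)) :
    ∃ μ : ℂ, ∃ q : ℍ, ‖μ‖ = 1 ∧ ‖q‖ = 1 ∧ ∀ x, f x = spinFourAct (μ : ℍ) q x := by
  -- the isometry preserves inner products
  set F : ℍ →ₗᵢ[ℝ] ℍ := { toLinearMap := f, norm_map' := hf } with hF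
  have hinner : ∀ x y, ⟪f x, f y⟫_ℝ = ⟪x, y⟫_ℝ := fun x y ↦ F.inner_map_map x y
  set u := f 1 with hu
  set v := f (quatBasis 2) with hv
  have hu1 : ‖u‖ = 1 := by rw [hu, hf, norm_one]
  have hj1 : ‖quatBasis 2‖ = 1 := by
    have h := Quaternion.normSq_eq_norm_mul_self (quatBasis 2)
    have h1 : normSq (quatBasis 2) = 1 := by simp [quatBasis, Quaternion.normSq_def']
    rw [h1] at h
    nlinarith [norm_nonneg (quatBasis 2)]
  have hv1 : ‖v‖ = 1 := by rw [hv, hf, hj1]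
  have hfi : f (quatBasis 1) = modelJ u := by
    have : quatBasis 1 = modelJ 1 := by rw [modelJ_eq, mul_one]
    rw [this, hJ]
  -- `w = v ū` has no `1`- and no `i`-component
  set w := v * star u with hw
  have hw_re : w.re = 0 := by
    have h1 : ⟪v, u⟫_ℝ = 0 := by
      rw [hv, hu, hinner, Quaternion.inner_def, star_one, mul_one]; simp [quatBasis]
    rwa [Quaternion.inner_def] at h1
  have hw_imI : w.imI = 0 := by
    have h1 : ⟪v, modelJ u⟫_ℝ = 0 := by
      rw [← hfi, hv, hinner, Quaternion.inner_def]
      have hs : star (quatBasis 1) = -quatBasis 1 := by ext <;> simp [quatBasis]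
      rw [hs]; simp [quatBasis]
    rwa [inner_modelJ_right] at h1
  -- `c = -j w` is a unit complex number
  set c : ℍ := -(quatBasis 2 * w) with hc
  have hc_imJ : c.imJ = 0 := by rw [hc, quatBasis_two_mul]; simp [hw_re]
  have hc_imK : c.imK = 0 := by rw [hc, quatBasis_two_mul]; simp [hw_imI]
  set z : ℂ := ⟨c.re, c.imI⟩ with hz
  have hcz : c = (z : ℍ) := eq_coeComplex_of_imJ_imK hc_imJ hc_imK
  have hc1 : ‖c‖ = 1 := by
    rw [hc, norm_neg, norm_mul, hj1, one_mul, hw, norm_mul, Quaternion.norm_star, hv1, hu1, one_mul]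
  have hz1 : ‖z‖ = 1 := by rw [← norm_coeComplex, ← hcz, hc1]
  -- a square root `ν` of `z`, `μ = ν̄`, `q = ū μ`
  obtain ⟨ν, hν⟩ := IsAlgClosed.exists_pow_nat_eq z (n := 2) two_pos
  have hν1 : ‖ν‖ = 1 := by
    have h2 : ‖ν‖ ^ 2 = 1 := by rw [← norm_pow, hν, hz1]
    nlinarith [norm_nonneg ν]
  set μ : ℂ := conj ν with hμ
  have hμ1 : ‖μ‖ = 1 := by rw [hμ, Complex.norm_conj, hν1]
  have hμμ : (μ : ℍ) * ((conj μ : ℂ) : ℍ) = 1 := by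
    rw [← coeComplex_mul, Complex.mul_conj, Complex.normSq_eq_norm_sq, hμ1]; simp
  have hconjμ_sq : ((conj μ : ℂ) : ℍ) * ((conj μ : ℂ) : ℍ) = c := by
    rw [← coeComplex_mul, hμ, Complex.conj_conj, ← sq, hν, ← hcz]
  set q : ℍ := star u * (μ : ℍ) with hq
  have hq1 : ‖q‖ = 1 := by rw [hq, norm_mul, Quaternion.norm_star, hu1, norm_coeComplex, hμ1, one_mul]
  have hstarq : star q = ((conj μ : ℂ) : ℍ) * u := by rw [hq, star_mul, star_star, star_coeComplex]
  have huu : star u * u = 1 := by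
    rw [Quaternion.star_mul_self, Quaternion.normSq_eq_norm_mul_self, hu1, mul_one, Quaternion.coe_one]
  -- the four basis values
  have e0 : spinFourAct (μ : ℍ) q 1 = u := by
    rw [spinFourAct, mul_one, hstarq, ← mul_assoc, hμμ, one_mul]
  have e1 : spinFourAct (μ : ℍ) q (quatBasis 1) = f (quatBasis 1) := by
    have h1 : quatBasis 1 = modelJ 1 := by rw [modelJ_eq, mul_one]
    rw [hfi, h1, ← modelJ_spinFourAct_coeComplex, e0]
  have e2 : spinFourAct (μ : ℍ) q (quatBasis 2) = v := by
    rw [spinFourAct, hstarq, coeComplex_mul_quatBasis_two, mul_assoc, ← mul_assoc ((conj μ : ℂ) : ℍ),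
      hconjμ_sq, hc, neg_mul, mul_neg, ← mul_assoc (quatBasis 2), ← mul_assoc (quatBasis 2),
      quatBasis_two_mul_self, neg_one_mul, neg_mul, neg_neg, hw, mul_assoc, huu, mul_one]
  have e3 : spinFourAct (μ : ℍ) q (quatBasis 3) = f (quatBasis 3) := by
    rw [← quatBasis_one_mul_two, ← modelJ_eq, ← modelJ_spinFourAct_coeComplex, e2, hv, hJ]
  refine ⟨μ, q, hμ1, hq1, fun x ↦ ?_⟩
  -- extend from the basis by linearity
  have key : ∀ k, f (quatBasis k) = spinFourAct (μ : ℍ) q (quatBasis k) := by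
    intro k
    fin_cases k
    · exact (congrArg f quatBasis_zero).trans e0.symm
    · exact e1.symm
    · exact e2.symm
    · exact e3.symm
  rw [← sum_components_smul_quatBasis x, map_sum]
  simp only [spinFourAct, Finset.mul_sum, Finset.sum_mul]
  refine Finset.sum_congr rfl fun k _ ↦ ?_
  rw [map_smul, key k, spinFourAct, Algebra.mul_smul_comm, Algebra.smul_mul_assoc]

end Literature.Geometry.GaugeTheory

end
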